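import Summits.Parity.BatemanHorn.Theorems.SoloInformedThinTypeIIVoid
import Summits.Parity.BatemanHorn.Theorems.SoloInformedThinTypeI
import Literature.Barriers.Parity.FordMaynardPrimeSievesMinimalTypeII
import HarnessLib

/-!
# Thin sequences vs. Type-I/II information, V: polynomial values (`n² + 1`)

Part of the `SoloInformedThin*` series (`…Counting`, `…TypeII`, `…TypeIIVoid`, `…TypeI`,
`…Polynomial`), which turns Ford–Maynard's heuristic remark (arXiv:2407.14368, §2.4: for the
normalised indicator of a set `𝒥 ⊆ (x/2, x]` with `x^{1-c}` elements "one can only hope for (I)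
to hold for `γ < 1 − c` and (II) for `θ > c`") into theorems about EVERY real sequence with thin
support, in the tree's exact formalisation `Literature.Barriers.Parity.FordMaynard.TypeI` /
`TypeII` (comparison sequence `b = 1`, `w = a − 1`).  The tree's barrier entry
`Literature.Barriers.Parity.FordMaynardLowLevel` flags the remark as "a HEURISTIC remark of the
paper, not a theorem about any specific thin set"; these files supply the theorem.

This file: the case of `Summit.Parity.BatemanHorn` with one polynomial of degree `d ≥ 2` (or any
system containing one).  A sequence supported on the values of a map `g : ℕ → ℕ` with
`g k ≥ k^d` has at most `x^{1/d} + 1` non-zero values on `(x/2, x]`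
(`exists_cover_of_polyGrowth`), hence, for `B > 1` and all large `x`:
* `eventually_not_typeII_of_polyGrowth` — `w = a − 1` violates (II) in EVERY range
  `0 ≤ θ < 1`, `ν > 0`;
* `eventually_not_typeI_of_polyGrowth` — `w = a − 1` violates (I) at every level `γ > 1/d`;
* `eventually_not_typeII_sq_add_one`, `eventually_not_typeI_sq_add_one` — the Landau /
  Hardy–Littlewood case `k² + 1` (`BatemanHorn` with `k = 1`, `f = X² + 1`): no Type-II window,
  Type-I level `≤ x^{1/2}`.

Reading (for the summit): in Ford–Maynard's axiomatisation of "the method of Type-I/II sums" a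
weighting of the values of one polynomial of degree `d ≥ 2` carries only Type-I information of
level `≤ x^{1/d} ≤ x^{1/2}` and no Type-II information — the regime where the tree's proved
entries `FordMaynardLowLevel_holds`, `FordMaynardMinimalTypeII_holds` and Selberg's example
(`SelbergParityBarrier`) exhibit admissible sequences without primes.  Nothing here is specific to
polynomials beyond the growth `g k ≥ k^d`; arithmetic input (equidistribution of roots, bilinear
structure of norm forms in TWO variables as in Friedlander–Iwaniec / Heath-Brown) is exactly what a
one-variable polynomial sequence lacks.

References: [cite: FordMaynard2024PrimeSieves, §2.4 (p. 7, first family and footnote)].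
-/

noncomputable section

open Filter Finset Real

namespace Summit.Parity.BatemanHorn.Theorems

open Literature.Barriers.Parity.FordMaynard (TypeI TypeII eventually_mul_rpow_le_rpow)

/-! ### Polynomial growth: the values of one polynomial of degree `d ≥ 2` -/

/-- A sequence supported (on `(x/2, x]`) on the values of `g` with `g k ≥ k^d` has at most
`x^{1/d} + 1` non-zero values there. [folklore] -/
theorem exists_cover_of_polyGrowth {d : ℕ} (hd : d ≠ 0) {g : ℕ → ℕ} (hg : ∀ k, k ^ d ≤ g k)
    {x : ℝ} (hx : 0 ≤ x) {a : ℕ → ℝ}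
    (ha : ∀ v : ℕ, x / 2 < (v : ℝ) → (v : ℝ) ≤ x → a v ≠ 0 → ∃ k, g k = v) :
    ∃ A : Finset ℕ, (A.card : ℝ) ≤ x ^ (1 / d : ℝ) + 1 ∧
      ∀ v : ℕ, x / 2 < (v : ℝ) → (v : ℝ) ≤ x → a v ≠ 0 → v ∈ A := by
  refine ⟨(range (⌊x ^ (1 / d : ℝ)⌋₊ + 1)).image g, ?_, ?_⟩
  · have h1 := card_image_le (s := range (⌊x ^ (1 / d : ℝ)⌋₊ + 1)) (f := g)
    rw [card_range] at h1
    have h2 : ((⌊x ^ (1 / d : ℝ)⌋₊ + 1 : ℕ) : ℝ) ≤ x ^ (1 / d : ℝ) + 1 := by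
      push_cast
      linarith [Nat.floor_le (Real.rpow_nonneg hx (1 / d : ℝ))]
    exact le_trans (by exact_mod_cast h1) h2
  · intro v h1 h2 h3
    obtain ⟨k, hk⟩ := ha v h1 h2 h3
    rw [mem_image]
    refine ⟨k, mem_range.mpr (Nat.lt_succ_of_le (Nat.le_floor ?_)), hk⟩
    have hkd : (k : ℝ) ^ d ≤ x := by
      have : ((k ^ d : ℕ) : ℝ) ≤ v := by exact_mod_cast (hg k).trans hk.le
      push_cast at this
      linarith
    calc (k : ℝ) = ((k : ℝ) ^ d) ^ (1 / d : ℝ) := by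
          rw [one_div, Real.pow_rpow_inv_natCast (Nat.cast_nonneg _) hd]
      _ ≤ x ^ (1 / d : ℝ) := Real.rpow_le_rpow (by positivity) hkd (by positivity)

/-- **Polynomial-growth supports admit NO Type-II window.**  Let `d ≥ 2`, `0 ≤ θ < 1`, `ν > 0`,
`B > 1`.  For all large `x`: if `g : ℕ → ℕ` satisfies `g k ≥ k^d` and the real sequence `a`
vanishes at every `v ∈ (x/2, x]` outside the image of `g` (e.g. `a` = any weighting of the values
`k² + 1`, or of the values of an integer polynomial of degree `d` with positive leading
coefficient, from the point where it dominates `k^d/C` after rescaling), then `w = a − 1`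
violates (II) in the range `[θ, θ + ν]`.  (Windows with `θ < 1 − 1/d` fail by
`eventually_not_typeII_of_sparse`; windows with `θ ≥ 1 − 1/d ≥ 1/2` reach above `1/d` and fail
by the reflected form.) [cite: FordMaynard2024PrimeSieves, §2.4] -/
theorem eventually_not_typeII_of_polyGrowth {d : ℕ} (hd : 2 ≤ d) {θ ν B : ℝ} (hθ : 0 ≤ θ)
    (hθ1 : θ < 1) (hν : 0 < ν) (hB : 1 < B) :
    ∀ᶠ x : ℝ in atTop, ∀ (g : ℕ → ℕ), (∀ k, k ^ d ≤ g k) → ∀ a : ℕ → ℝ,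
      (∀ v : ℕ, x / 2 < (v : ℝ) → (v : ℝ) ≤ x → a v ≠ 0 → ∃ k, g k = v) →
      ¬ TypeII (fun n : ℕ => a n - 1) x θ ν B := by
  have hd0 : d ≠ 0 := by omega
  have hdr : (2 : ℝ) ≤ d := by exact_mod_cast hd
  have hdinv : (1 : ℝ) / d ≤ 1 / 2 := by
    rw [div_le_div_iff₀ (by positivity) (by norm_num)]; linarith
  have hdpos : (0 : ℝ) < 1 / d := by positivity
  by_cases hcase : θ < 1 - 1 / d
  · -- unreflected form with `θ < c < 1 - 1/d`
    set c : ℝ := (θ + (1 - 1 / d)) / 2 with hcdef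
    have hθc : θ < c := by rw [hcdef]; linarith
    have hc1 : c < 1 - 1 / d := by rw [hcdef]; linarith
    filter_upwards [eventually_not_typeII_of_sparse hθ hθc (by linarith) hν hB,
      eventually_mul_rpow_le_rpow 2 (by linarith : 1 / (d : ℝ) < 1 - c),
      eventually_ge_atTop (1 : ℝ)] with x hx e1 hx1 g hg a ha
    obtain ⟨A, hA, hcov⟩ := exists_cover_of_polyGrowth hd0 hg (by linarith) ha
    have hx1d : 1 ≤ x ^ (1 / d : ℝ) := Real.one_le_rpow hx1 hdpos.le
    exact hx a A (by linarith) hcov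
  · -- reflected form with `max(1-θ-ν, 0) < c < 1 - 1/d`
    push Not at hcase
    have hm0 : (0 : ℝ) ≤ max (1 - θ - ν) 0 := le_max_right _ _
    have hm1 : 1 - θ - ν ≤ max (1 - θ - ν) 0 := le_max_left _ _
    have hmax : max (1 - θ - ν) 0 < 1 - 1 / d := max_lt (by linarith) (by linarith)
    set c : ℝ := (max (1 - θ - ν) 0 + (1 - 1 / d)) / 2 with hcdef
    have hc0 : 0 < c := by rw [hcdef]; linarith
    have hcw : 1 - c < θ + ν := by rw [hcdef]; linarith
    have hc1 : c < 1 - 1 / d := by rw [hcdef]; linarith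
    filter_upwards [eventually_not_typeII_of_sparse' hθ hθ1 hν hc0 hcw hB,
      eventually_mul_rpow_le_rpow 2 (by linarith : 1 / (d : ℝ) < 1 - c),
      eventually_ge_atTop (1 : ℝ)] with x hx e1 hx1 g hg a ha
    obtain ⟨A, hA, hcov⟩ := exists_cover_of_polyGrowth hd0 hg (by linarith) ha
    have hx1d : 1 ≤ x ^ (1 / d : ℝ) := Real.one_le_rpow hx1 hdpos.le
    exact hx a A (by linarith) hcov

/-- **Polynomial-growth supports have Type-I level at most `x^{1/d}`.**  Let `d ≥ 2`, `γ > 1/d`,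
`B > 1`.  For all large `x`: if `g k ≥ k^d` and `a` vanishes on `(x/2, x]` outside the image of
`g`, then `w = a − 1` violates (I) at level `x^γ`. [cite: FordMaynard2024PrimeSieves, §2.4] -/
theorem eventually_not_typeI_of_polyGrowth {d : ℕ} (hd : 2 ≤ d) {γ B : ℝ}
    (hγ : (1 : ℝ) / d < γ) (hB : 1 < B) :
    ∀ᶠ x : ℝ in atTop, ∀ (g : ℕ → ℕ), (∀ k, k ^ d ≤ g k) → ∀ a : ℕ → ℝ,
      (∀ v : ℕ, x / 2 < (v : ℝ) → (v : ℝ) ≤ x → a v ≠ 0 → ∃ k, g k = v) →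
      ¬ TypeI (fun n : ℕ => a n - 1) x γ B := by
  have hd0 : d ≠ 0 := by omega
  have hdr : (2 : ℝ) ≤ d := by exact_mod_cast hd
  have hdinv : (1 : ℝ) / d ≤ 1 / 2 := by
    rw [div_le_div_iff₀ (by positivity) (by norm_num)]; linarith
  have hdpos : (0 : ℝ) < 1 / d := by positivity
  -- reduce to the level `γ' = min γ 1`
  set γ' : ℝ := min γ 1 with hγ'def
  have hγ'γ : γ' ≤ γ := min_le_left _ _
  have hγ'1 : γ' ≤ 1 := min_le_right _ _
  have hγ'd : 1 / (d : ℝ) < γ' := lt_min hγ (by linarith)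
  set c : ℝ := ((1 - γ') + (1 - 1 / d)) / 2 with hcdef
  have hc0 : 0 < c := by rw [hcdef]; linarith
  have hc1 : c ≤ 1 := by rw [hcdef]; linarith
  have hcγ : 1 - c < γ' := by rw [hcdef]; linarith
  have hc1d : c < 1 - 1 / d := by rw [hcdef]; linarith
  filter_upwards [eventually_not_typeI_of_sparse hc0 hc1 hcγ hB,
    eventually_mul_rpow_le_rpow 2 (by linarith : 1 / (d : ℝ) < 1 - c),
    eventually_ge_atTop (1 : ℝ)] with x hx e1 hx1 g hg a ha hI
  obtain ⟨A, hA, hcov⟩ := exists_cover_of_polyGrowth hd0 hg (by linarith) ha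
  have hx1d : 1 ≤ x ^ (1 / d : ℝ) := Real.one_le_rpow hx1 hdpos.le
  exact hx a A (by linarith) hcov
    (Literature.Barriers.Parity.FordMaynard.TypeI.mono_level hx1 hγ'γ hI)

/-- **The Landau / Hardy–Littlewood `n² + 1` case** (`BatemanHorn` with `k = 1`, `f = X² + 1`):
no weighting of the numbers `k² + 1` in `(x/2, x]` carries Type-II information in any window
`[θ, θ+ν]`, `0 ≤ θ < 1`, `ν > 0` (`B > 1`, `x` large). [cite: FordMaynard2024PrimeSieves, §2.4] -/
theorem eventually_not_typeII_sq_add_one {θ ν B : ℝ} (hθ : 0 ≤ θ) (hθ1 : θ < 1) (hν : 0 < ν)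
    (hB : 1 < B) :
    ∀ᶠ x : ℝ in atTop, ∀ a : ℕ → ℝ,
      (∀ v : ℕ, x / 2 < (v : ℝ) → (v : ℝ) ≤ x → a v ≠ 0 → ∃ k, k ^ 2 + 1 = v) →
      ¬ TypeII (fun n : ℕ => a n - 1) x θ ν B := by
  filter_upwards [eventually_not_typeII_of_polyGrowth (le_refl 2) hθ hθ1 hν hB] with x hx a ha
  exact hx (fun k => k ^ 2 + 1) (fun k => Nat.le_succ _) a ha

/-- … and no such weighting has Type-I information at any level `x^γ`, `γ > 1/2`.
[cite: FordMaynard2024PrimeSieves, §2.4] -/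
theorem eventually_not_typeI_sq_add_one {γ B : ℝ} (hγ : 1 / 2 < γ) (hB : 1 < B) :
    ∀ᶠ x : ℝ in atTop, ∀ a : ℕ → ℝ,
      (∀ v : ℕ, x / 2 < (v : ℝ) → (v : ℝ) ≤ x → a v ≠ 0 → ∃ k, k ^ 2 + 1 = v) →
      ¬ TypeI (fun n : ℕ => a n - 1) x γ B := by
  have h : (1 : ℝ) / (2 : ℕ) < γ := by push_cast; linarith
  filter_upwards [eventually_not_typeI_of_polyGrowth (le_refl 2) h hB] with x hx a ha
  exact hx (fun k => k ^ 2 + 1) (fun k => Nat.le_succ _) a ha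

end Summit.Parity.BatemanHorn.Theorems

end
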